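import Summits.Langlands.Langlands.Theses.FrobeniusMomentIrreducibility
import Literature.NumberTheory.Automorphic.AutomorphicInductionCuspidalProofs
import Literature.NumberTheory.Automorphic.AutomorphicLFunctionHolds
import Literature.NumberTheory.Automorphic.SatakeParameterBoundHolds
import Literature.NumberTheory.Automorphic.CuspidalDescentDetCubicRepData
import Literature.NumberTheory.Automorphic.AutomorphicTwistHecke
import Literature.NumberTheory.Automorphic.CuspidalContragredientProofs
import Literature.NumberTheory.Automorphic.IdeleNormDetGL
import HarnessLib

/-!
# Route `FrobeniusMomentIrreducibility`, item `IrreducibleOfMoments` (stmt-Langlands-19275) — part 1/3: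
# the automorphic upper bound `∑_{v ∉ S} |tr A_v|² q_v^{-σ} ≤ log 1/(σ-1) + O(1)`

For a cuspidal Borel–Jacquet datum `π` on `GL_n(𝔸_F)` (`n ≥ 1`) we produce the unitary (`L²`)
normalisation of its Satake parameters, `t_{π,w} = q_w^{s} α_P(w)` off a finite `S`
(`CuspidalAutomorphicRepData.exists_satake_eq_cpow_mul_L2_unconditional`), and — GRANTED the route's crux
`PairLPoleJS` (the simple pole of `L^S(s, π₀ × π₀^∨)` at `s = 1`, Jacquet–Shalika 1981 Prop. 3.6, as a
HYPOTHESIS, applied to the norm twist `π₀ = π ⊗ ‖det‖^{-s}` and its contragredient datum) — the bound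
`∑_{w ∉ S} |∑ α_P(w)|² q_w^{-σ} ≤ log 1/(σ-1) + C` as `σ → 1⁺`.  The analysis is Jacquet–Shalika's
p. 556: `L_S(σ, π × π̄) = exp ∑_{w ∉ S} ∑_{k ≥ 1} |tr A_w^k|² / (k q_w^{kσ})` for real `σ > 1` (the double
series converges by the tree's theorem (J) `summable_normSq_trace_largeFinset_holds`, the local factors by
`|α| ≤ q_w^{1/2}`, `norm_satakeParameter_le_sqrt_holds`), the `k = 1` slice is the sum to bound, and a
simple pole forces `exp(∑) ≤ (|c| + 1)/(σ - 1)` near `1`.  No named unproved fact is used.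

References: H. Jacquet, J. Shalika, *On Euler products and the classification of automorphic
representations* I, Amer. J. Math. 103 (1981), (5.3.3) p. 556 and Prop. (3.6); A. Borel, H. Jacquet,
Corvallis (1979), 5.7.
-/

noncomputable section

set_option linter.dupNamespace false -- project-wide option (lakefile weak.linter.dupNamespace); `Summit.Langlands.Langlands` is the mandated namespace

open scoped NumberField ComplexConjugate Topology
open Filter IsDedekindDomain Polynomial Complex
open Literature.NumberTheory.Automorphic Literature.NumberTheory.GaloisRepresentations

namespace Summit.Langlands.Langlands.Theorems.FrobeniusMomentIrreducibilityIrreducibleOfMoments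

variable {F : Type} [Field F] [NumberField F]

/-! ### §1 The analysis: a simple pole at `1` bounds the first moment of `|tr A_w|²` -/

/-- **`L_S(σ, π × π̄) = exp ∑_{(k,w)} |p_{k+1}(α_w)|² / ((k+1) q_w^{(k+1)σ})` for real `σ > 1`**
(Jacquet–Shalika 1981, p. 556, (1)–(4)), granted the local bound `|a| ≤ q_w^{1/2}` and the convergence
of the double series at `σ`: sum each fibre `w` first (`hasSum_normSq_powerSum_mul_pow_div`), then
exponentiate (`HasSum.cexp`, `exp_neg_sum_log_eq_inv_eval_satakePairPolynomial_conj`).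
[cite: JacquetShalikaAJM1981, (5.3.3) p. 556] -/
theorem hasProd_inv_eval_satakePairPolynomial_conj {S : Set (HeightOneSpectrum (𝓞 F))}
    {α : SatakeFamily F} (hb : ∀ w ∉ S, ∀ a ∈ α w, ‖a‖ ≤ Real.sqrt w.residueCard) {σ : ℝ}
    (hσ : 1 < σ)
    (hsum : Summable fun i : ℕ × {w : HeightOneSpectrum (𝓞 F) // w ∉ S} =>
      jsCoeff S α i * (jsBase S i : ℝ) ^ (-σ)) :
    HasProd (fun w : {w : HeightOneSpectrum (𝓞 F) // w ∉ S} =>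
        ((satakePairPolynomial (α w.1) ((α w.1).map conj)).eval
          ((w.1.residueCard : ℂ) ^ (-(σ : ℂ))))⁻¹)
      (cexp ((∑' i : ℕ × {w : HeightOneSpectrum (𝓞 F) // w ∉ S},
        jsCoeff S α i * (jsBase S i : ℝ) ^ (-σ) : ℝ) : ℂ)) := by
  -- the double series, in `ℂ`
  have hL : HasSum (fun i : ℕ × {w : HeightOneSpectrum (𝓞 F) // w ∉ S} =>
      (jsCoeff S α i : ℂ) * (jsBase S i : ℂ) ^ (-(σ : ℂ)))
      ((∑' i : ℕ × {w : HeightOneSpectrum (𝓞 F) // w ∉ S},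
        jsCoeff S α i * (jsBase S i : ℝ) ^ (-σ) : ℝ) : ℂ) := by
    refine (Complex.hasSum_ofReal.mpr hsum.hasSum).congr_fun fun i => ?_
    rw [Complex.ofReal_mul, Complex.ofReal_cpow (Nat.cast_nonneg _), Complex.ofReal_natCast,
      Complex.ofReal_neg]
  -- the local condition `q_w · q_w^{-σ} < 1`
  have hx : ∀ w : {w : HeightOneSpectrum (𝓞 F) // w ∉ S},
      Real.sqrt w.1.residueCard * Real.sqrt w.1.residueCard *
        ‖(w.1.residueCard : ℂ) ^ (-(σ : ℂ))‖ < 1 := by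
    intro w
    have hq1 : (1 : ℝ) < w.1.residueCard := by exact_mod_cast w.1.one_lt_residueCard
    have hq0 : (0 : ℝ) < w.1.residueCard := zero_lt_one.trans hq1
    rw [Real.mul_self_sqrt hq0.le,
      Complex.norm_natCast_cpow_of_pos (zero_lt_one.trans w.1.one_lt_residueCard), neg_re,
      Complex.ofReal_re]
    have h : (w.1.residueCard : ℝ) * (w.1.residueCard : ℝ) ^ (-σ) =
        (w.1.residueCard : ℝ) ^ (1 + -σ) := by
      rw [Real.rpow_add hq0, Real.rpow_one]
    rw [h]
    exact Real.rpow_lt_one_of_one_lt_of_neg hq1 (by linarith)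
  -- fibrewise sums
  set g : {w : HeightOneSpectrum (𝓞 F) // w ∉ S} → ℂ := fun w =>
    -((satakeTensor (α w.1) ((α w.1).map conj)).map fun c =>
      Complex.log (1 - c * ((w.1.residueCard : ℂ) ^ (-(σ : ℂ))))).sum with hg
  have hfib : ∀ w : {w : HeightOneSpectrum (𝓞 F) // w ∉ S},
      HasSum (fun k : ℕ => (jsCoeff S α (k, w) : ℂ) * (jsBase S (k, w) : ℂ) ^ (-(σ : ℂ))) (g w) := by
    intro w
    refine (hasSum_normSq_powerSum_mul_pow_div (hb w.1 w.2) (hx w)).congr_fun fun k => ?_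
    rw [jsCoeff_mul_cpow_neg]
  have hG : HasSum g ((∑' i : ℕ × {w : HeightOneSpectrum (𝓞 F) // w ∉ S},
      jsCoeff S α i * (jsBase S i : ℝ) ^ (-σ) : ℝ) : ℂ) :=
    HasSum.prod_fiberwise
      ((Equiv.prodComm {w : HeightOneSpectrum (𝓞 F) // w ∉ S} ℕ).hasSum_iff.mpr hL) hfib
  have hP := hG.cexp
  have hfun : (cexp ∘ g) = fun w : {w : HeightOneSpectrum (𝓞 F) // w ∉ S} =>
      ((satakePairPolynomial (α w.1) ((α w.1).map conj)).eval
        ((w.1.residueCard : ℂ) ^ (-(σ : ℂ))))⁻¹ := by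
    funext w
    simp only [Function.comp_apply, hg]
    exact exp_neg_sum_log_eq_inv_eval_satakePairPolynomial_conj (hb w.1 w.2) (hx w)
  rwa [hfun] at hP

/-- **The `k = 1` slice**: `∑_{w ∉ S} |∑ α_w|² q_w^{-σ} ≤ ∑_{(k,w)} |p_{k+1}(α_w)|² / ((k+1) q_w^{(k+1)σ})`
(non-negative terms; the slice is the sub-family `w ↦ (0, w)`). [folklore] -/
theorem tsum_normSq_sum_le_tsum_jsCoeff {S : Set (HeightOneSpectrum (𝓞 F))} {α : SatakeFamily F}
    {σ : ℝ}
    (hsum : Summable fun i : ℕ × {w : HeightOneSpectrum (𝓞 F) // w ∉ S} =>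
      jsCoeff S α i * (jsBase S i : ℝ) ^ (-σ)) :
    (Summable fun w : {w : HeightOneSpectrum (𝓞 F) // w ∉ S} =>
        ‖(α w.1).sum‖ ^ 2 * (w.1.residueCard : ℝ) ^ (-σ)) ∧
      ∑' w : {w : HeightOneSpectrum (𝓞 F) // w ∉ S}, ‖(α w.1).sum‖ ^ 2 * (w.1.residueCard : ℝ) ^ (-σ) ≤
        ∑' i : ℕ × {w : HeightOneSpectrum (𝓞 F) // w ∉ S}, jsCoeff S α i * (jsBase S i : ℝ) ^ (-σ) := by
  have hinj : Function.Injective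
      (fun w : {w : HeightOneSpectrum (𝓞 F) // w ∉ S} => ((0 : ℕ), w)) :=
    fun w w' h => (Prod.mk.inj h).2
  have hslice : ∀ w : {w : HeightOneSpectrum (𝓞 F) // w ∉ S},
      jsCoeff S α (0, w) * (jsBase S (0, w) : ℝ) ^ (-σ) =
        ‖(α w.1).sum‖ ^ 2 * (w.1.residueCard : ℝ) ^ (-σ) := by
    intro w
    simp only [jsCoeff, jsBase, zero_add, pow_one, Multiset.map_id', Nat.cast_zero, div_one]
  have hcomp : (fun w : {w : HeightOneSpectrum (𝓞 F) // w ∉ S} =>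
      ‖(α w.1).sum‖ ^ 2 * (w.1.residueCard : ℝ) ^ (-σ)) =
      (fun i : ℕ × {w : HeightOneSpectrum (𝓞 F) // w ∉ S} =>
        jsCoeff S α i * (jsBase S i : ℝ) ^ (-σ)) ∘
        (fun w : {w : HeightOneSpectrum (𝓞 F) // w ∉ S} => ((0 : ℕ), w)) := by
    funext w
    exact (hslice w).symm
  refine ⟨?_, ?_⟩
  · rw [hcomp]
    exact hsum.comp_injective hinj
  · rw [hcomp]
    exact tsum_comp_le_tsum_of_inj hsum
      (fun i => mul_nonneg (jsCoeff_nonneg S α i) (Real.rpow_nonneg (Nat.cast_nonneg _) _)) hinj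

/-- **A simple pole of `L_S(s, π × π̄)` at `s = 1` bounds `∑_{w ∉ S} |tr A_w|² q_w^{-σ}` by
`log 1/(σ-1) + log(|c| + 1)` as `σ → 1⁺`** (Jacquet–Shalika 1981, p. 556 with Prop. (3.6)): on the
real axis `L_S(σ) = exp T(σ)` with `T(σ) ≥` the sum in question, and `(σ - 1) L_S(σ) → c` gives
`(σ - 1) exp T(σ) ≤ |c| + 1` near `1`. [cite: JacquetShalikaAJM1981, (5.3.3) p. 556 and Prop. (3.6)] -/
theorem eventually_tsum_normSq_sum_le_of_pole {S : Set (HeightOneSpectrum (𝓞 F))}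
    {α : SatakeFamily F} (hb : ∀ w ∉ S, ∀ a ∈ α w, ‖a‖ ≤ Real.sqrt w.residueCard)
    (hsum : ∀ σ : ℝ, 1 < σ → Summable fun i : ℕ × {w : HeightOneSpectrum (𝓞 F) // w ∉ S} =>
      jsCoeff S α i * (jsBase S i : ℝ) ^ (-σ))
    {c : ℂ} (hc : Tendsto (fun s : ℂ => (s - 1) *
      ∏' w : {w : HeightOneSpectrum (𝓞 F) // w ∉ S},
        ((satakePairPolynomial (α w.1) ((α w.1).map conj)).eval
          ((w.1.residueCard : ℂ) ^ (-s)))⁻¹) (𝓝[{s : ℂ | 1 < s.re}] 1) (𝓝 c)) :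
    ∀ᶠ σ : ℝ in 𝓝[>] (1 : ℝ),
      ∑' w : {w : HeightOneSpectrum (𝓞 F) // w ∉ S}, ‖(α w.1).sum‖ ^ 2 * (w.1.residueCard : ℝ) ^ (-σ) ≤
        Real.log (1 / (σ - 1)) + Real.log (‖c‖ + 1) := by
  -- restrict the limit to the real axis
  have h1 : Tendsto (fun σ : ℝ => (σ : ℂ)) (𝓝[>] (1 : ℝ)) (𝓝[{s : ℂ | 1 < s.re}] (1 : ℂ)) := by
    refine tendsto_nhdsWithin_iff.mpr ⟨?_, ?_⟩
    · have h := (Complex.continuous_ofReal.tendsto (1 : ℝ)).mono_left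
        (nhdsWithin_le_nhds (s := Set.Ioi (1 : ℝ)))
      rwa [Complex.ofReal_one] at h
    · filter_upwards [self_mem_nhdsWithin] with σ hσ
      simpa only [Set.mem_setOf_eq, Complex.ofReal_re, Set.mem_Ioi] using hσ
  have hT := (hc.comp h1).norm
  have hM : (0 : ℝ) < ‖c‖ + 1 := by positivity
  have hev := hT.eventually (Iio_mem_nhds (lt_add_one ‖c‖))
  filter_upwards [hev, self_mem_nhdsWithin] with σ hσ hσ1
  have hσ1' : 1 < σ := hσ1
  set T : ℝ := ∑' i : ℕ × {w : HeightOneSpectrum (𝓞 F) // w ∉ S},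
    jsCoeff S α i * (jsBase S i : ℝ) ^ (-σ) with hTdef
  have hZ := (hasProd_inv_eval_satakePairPolynomial_conj hb hσ1' (hsum σ hσ1')).tprod_eq
  -- `‖(σ - 1) L_S(σ)‖ = (σ - 1) exp T(σ) < ‖c‖ + 1`
  have hnorm : ‖((σ : ℂ) - 1) * ∏' w : {w : HeightOneSpectrum (𝓞 F) // w ∉ S},
      ((satakePairPolynomial (α w.1) ((α w.1).map conj)).eval
        ((w.1.residueCard : ℂ) ^ (-(σ : ℂ))))⁻¹‖ = (σ - 1) * Real.exp T := by
    rw [hZ, norm_mul, Complex.norm_exp_ofReal, ← Complex.ofReal_one, ← Complex.ofReal_sub,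
      Complex.norm_real, Real.norm_eq_abs, abs_of_pos (sub_pos.mpr hσ1')]
  have hlt : (σ - 1) * Real.exp T < ‖c‖ + 1 := by
    have h := hσ
    simp only [Function.comp_apply] at h
    rwa [hnorm] at h
  have hσ0 : 0 < σ - 1 := sub_pos.mpr hσ1'
  have hexp : Real.exp T < (‖c‖ + 1) / (σ - 1) := by
    rw [lt_div_iff₀ hσ0, mul_comm]
    exact hlt
  have hTle : T < Real.log (1 / (σ - 1)) + Real.log (‖c‖ + 1) := by
    have h := (Real.lt_log_iff_exp_lt (div_pos hM hσ0)).mpr hexp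
    rw [Real.log_div hM.ne' hσ0.ne'] at h
    rw [one_div, Real.log_inv]
    linarith
  exact ((tsum_normSq_sum_le_tsum_jsCoeff (hsum σ hσ1')).2.trans hTle.le)

/-! ### §2 The automorphic package of a cuspidal datum, granted `PairLPoleJS` -/

/-- **Unitary normalisation and the first-moment bound for a cuspidal datum `π` on `GL_n(𝔸_F)`,
`n ≥ 1`, granted the crux `PairLPoleJS`.**  There are `s ∈ ℂ`, a finite set of places `S`, a family
`α_P` of multisets and a constant `C` with: `t_{π,w} = q_w^{s} α_P(w)` is THE Satake parameter of `π`
at every `w ∉ S` (`exists_satake_eq_cpow_mul_L2_unconditional`: `α_P` is a Satake family of a cuspidal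
`P ⊂ L²_cusp`), `card α_P(w) = n`, `|∏ α_P(w)| = 1` (unitary central character,
`HasSatakeParameterAt.norm_prod_eq_one`), the family `w ↦ |∑ α_P(w)|² q_w^{-σ}` is summable for
`σ > 1` (slice of (J), `summable_normSq_trace_largeFinset_holds`) and
`∑_{w ∉ S} |∑ α_P(w)|² q_w^{-σ} ≤ log 1/(σ-1) + C` as `σ → 1⁺` — the pole hypothesis being applied
to the twist `π₀ = π ⊗ (‖·‖^{s} ∘ det)` (`exists_heckeCharacter_ideleNorm_cpow`,
`exists_twist_hecke_hasSatakeParamAt`: Satake parameters `α_P(w)` a.e.) and its contragredient datum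
(`exists_contragredient_satake_holds`: parameters `α_P(w)⁻¹ = conj α_P(w)`,
`IsSatakeFamilyOf.map_inv_eq_map_conj`). [cite: JacquetShalikaAJM1981, Prop. (3.6) and (5.3.3)]
[cite: BorelJacquet1979, 5.7] -/
theorem exists_unitary_normalisation_bound {n : ℕ} (hn : 0 < n)
    (hcpt : isCompact_glFiniteIntegralLevel n F) (π : CuspidalAutomorphicRepData n F hcpt)
    (hJS : Summit.Langlands.Langlands.Theses.FrobeniusMomentIrreducibility.PairLPoleJS) :
    ∃ (s : ℂ) (S : Finset (HeightOneSpectrum (𝓞 F))) (αP : SatakeFamily F) (C : ℝ),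
      (∀ w ∉ (↑S : Set (HeightOneSpectrum (𝓞 F))), ∀ β : Multiset ℂ,
        π.1.HasSatakeParamAt w β ↔ β = (αP w).map (((w.residueCard : ℂ) ^ s) * ·)) ∧
      (∀ w ∉ (↑S : Set (HeightOneSpectrum (𝓞 F))), Multiset.card (αP w) = n) ∧
      (∀ w ∉ (↑S : Set (HeightOneSpectrum (𝓞 F))), ‖(αP w).prod‖ = 1) ∧
      (∀ σ : ℝ, 1 < σ → Summable fun w : {w : HeightOneSpectrum (𝓞 F) // w ∉ (↑S : Set _)} =>
        ‖(αP w.1).sum‖ ^ 2 * (w.1.residueCard : ℝ) ^ (-σ)) ∧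
      ∀ᶠ σ : ℝ in 𝓝[>] (1 : ℝ),
        ∑' w : {w : HeightOneSpectrum (𝓞 F) // w ∉ (↑S : Set _)},
          ‖(αP w.1).sum‖ ^ 2 * (w.1.residueCard : ℝ) ^ (-σ) ≤ Real.log (1 / (σ - 1)) + C := by
  classical
  haveI : NeZero n := ⟨hn.ne'⟩
  obtain ⟨μ, hμ⟩ := AdelicGroupData.exists_isAutomorphicMeasure_gl_holds (n := n) (K := F)
  haveI := hμ
  -- unitary normalisation `t_{π,w} = q_w^s α_P(w)`
  obtain ⟨s, P, SP, αP, hSPfin, hαP, hiff⟩ :=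
    CuspidalAutomorphicRepData.exists_satake_eq_cpow_mul_L2_unconditional hcpt μ π
  -- (J) for `P`
  obtain ⟨SJ, hSJ⟩ := summable_normSq_trace_largeFinset_holds (μ := μ) P
  -- the twist `π₀ = π ⊗ ‖det‖^s` and its contragredient datum
  obtain ⟨χ, hχ⟩ := exists_heckeCharacter_ideleNorm_cpow F s
  obtain ⟨π₀, hπ₀⟩ := CuspidalAutomorphicRepData.exists_twist_hecke_hasSatakeParamAt χ π
  obtain ⟨π₀', hπ₀'⟩ := CuspidalAutomorphicRepData.exists_contragredient_satake_holds hcpt π₀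
  have hEtw : {v : HeightOneSpectrum (𝓞 F) | ¬ ∀ α : Multiset ℂ, π.1.HasSatakeParamAt v α →
      π₀.1.HasSatakeParamAt v (α.map (χ.valueAtUniformizer v * ·))}.Finite :=
    Filter.eventually_cofinite.mp hπ₀
  -- the pole hypothesis for `(π₀, π₀')`
  obtain ⟨S₀, hS₀fin, hpole⟩ := hJS n F hcpt hn π₀ π₀'
  -- one finite set of bad places
  set T : Finset (HeightOneSpectrum (𝓞 F)) :=
    hS₀fin.toFinset ∪ SJ ∪ hSPfin.toFinset ∪ hEtw.toFinset with hTdef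
  have hS₀T : S₀ ⊆ (↑T : Set (HeightOneSpectrum (𝓞 F))) := by
    intro v hv
    simp only [hTdef, Finset.coe_union, Set.Finite.coe_toFinset, Set.mem_union]
    exact Or.inl (Or.inl (Or.inl hv))
  have hSJT : SJ ⊆ T := by
    intro v hv
    simp only [hTdef, Finset.mem_union, Set.Finite.mem_toFinset]
    exact Or.inl (Or.inl (Or.inr hv))
  have hSPT : SP ⊆ (↑T : Set (HeightOneSpectrum (𝓞 F))) := by
    intro v hv
    simp only [hTdef, Finset.coe_union, Set.Finite.coe_toFinset, Set.mem_union]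
    exact Or.inl (Or.inr hv)
  have hET : ∀ v ∉ (↑T : Set (HeightOneSpectrum (𝓞 F))), ∀ α : Multiset ℂ,
      π.1.HasSatakeParamAt v α → π₀.1.HasSatakeParamAt v (α.map (χ.valueAtUniformizer v * ·)) := by
    intro v hv
    by_contra h
    apply hv
    simp only [hTdef, Finset.coe_union, Set.Finite.coe_toFinset, Set.mem_union, Set.mem_setOf_eq]
    exact Or.inr h
  have hαT : IsSatakeFamilyOf P (↑T : Set (HeightOneSpectrum (𝓞 F))) αP := hαP.mono hSPT
  -- Satake parameters of `π₀` and `π₀'` off `T`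
  have hq0 : ∀ w : HeightOneSpectrum (𝓞 F), (w.residueCard : ℂ) ^ s ≠ 0 := fun w h => by
    have hq : (w.residueCard : ℂ) ≠ 0 := by
      exact_mod_cast (zero_lt_one.trans w.one_lt_residueCard).ne'
    exact hq ((Complex.cpow_eq_zero_iff _ _).mp h).1
  have h1 : ∀ w ∉ (↑T : Set (HeightOneSpectrum (𝓞 F))), π₀.1.HasSatakeParamAt w (αP w) := by
    intro w hw
    have hπw : π.1.HasSatakeParamAt w ((αP w).map (((w.residueCard : ℂ) ^ s) * ·)) :=
      (hiff w (fun h => hw (hSPT h)) _).mpr rfl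
    have h := hET w hw _ hπw
    rw [Multiset.map_map, HeckeCharacter.valueAtUniformizer_of_cpow hχ w] at h
    have hid : ((fun x => ((w.residueCard : ℂ) ^ s)⁻¹ * x) ∘ fun x => (w.residueCard : ℂ) ^ s * x) =
        id := by
      funext x
      simp only [Function.comp_apply, id_eq, inv_mul_cancel_left₀ (hq0 w)]
    rwa [hid, Multiset.map_id] at h
  have h2 : ∀ w ∉ (↑T : Set (HeightOneSpectrum (𝓞 F))),
      π₀'.1.HasSatakeParamAt w ((fun w => (αP w).map (·⁻¹)) w) :=
    fun w hw => hπ₀' w _ (h1 w hw)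
  have h3 : ∀ w ∉ (↑T : Set (HeightOneSpectrum (𝓞 F))), ‖(αP w).prod‖ = 1 := by
    intro w hw
    obtain ⟨𝔫, -, -, ϖ, hSat⟩ := hαT w hw
    exact hSat.norm_prod_eq_one
  have h4 : ∀ w ∉ (↑T : Set (HeightOneSpectrum (𝓞 F))),
      ‖((fun w => (αP w).map (·⁻¹)) w).prod‖ = 1 := by
    intro w hw
    rw [Multiset.prod_map_inv', norm_inv, h3 w hw, inv_one]
  have hX : ∀ᶠ w : HeightOneSpectrum (𝓞 F) in cofinite,
      (αP w).map ((((w.residueCard : ℂ) ^ ((1 : ℂ) - 1))) * ·) =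
        ((fun w => (αP w).map (·⁻¹)) w).map (·⁻¹) :=
    Filter.Eventually.of_forall fun w => by
      simp only [sub_self, Complex.cpow_zero, one_mul, Multiset.map_map, Function.comp_def, inv_inv,
        Multiset.map_id']
  obtain ⟨c, -, hc⟩ := hpole T.finite_toSet hS₀T h1 h2 h3 h4 Complex.one_re hX
  -- `α_P(w)⁻¹ = conj α_P(w)` off `T`
  have hconj : ∀ w ∉ (↑T : Set (HeightOneSpectrum (𝓞 F))),
      (αP w).map (·⁻¹) = (αP w).map conj := fun w hw => hαT.map_inv_eq_map_conj hw
  have hkey : (fun z : ℂ => (z - 1) * ∏' w : {w : HeightOneSpectrum (𝓞 F) // w ∉ (↑T : Set _)},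
      ((satakePairPolynomial (αP w.1) ((fun w => (αP w).map (·⁻¹)) w.1)).eval
        ((w.1.residueCard : ℂ) ^ (-z)))⁻¹) =
      fun z : ℂ => (z - 1) * ∏' w : {w : HeightOneSpectrum (𝓞 F) // w ∉ (↑T : Set _)},
        ((satakePairPolynomial (αP w.1) ((αP w.1).map conj)).eval
          ((w.1.residueCard : ℂ) ^ (-z)))⁻¹ := by
    funext z
    congr 1
    exact tprod_congr fun w => by simp only [hconj w.1 w.2]
  rw [hkey] at hc
  -- the local bound and (J), in the `jsCoeff` spelling
  have hb : ∀ w ∉ (↑T : Set (HeightOneSpectrum (𝓞 F))), ∀ a ∈ αP w,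
      ‖a‖ ≤ Real.sqrt w.residueCard :=
    fun w hw a ha => norm_satakeParameter_le_sqrt_holds (μ := μ) P hαT hw ha
  have hsumJ : ∀ σ : ℝ, 1 < σ →
      Summable fun i : ℕ × {w : HeightOneSpectrum (𝓞 F) // w ∉ (↑T : Set _)} =>
        jsCoeff (↑T : Set (HeightOneSpectrum (𝓞 F))) αP i *
          (jsBase (↑T : Set (HeightOneSpectrum (𝓞 F))) i : ℝ) ^ (-σ) := by
    intro σ hσ
    refine (hSJ hSJT hαT hσ).congr fun i => ?_
    rw [jsCoeff_mul_rpow_neg]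
  refine ⟨s, T, αP, Real.log (‖c‖ + 1), fun w hw => hiff w fun h => hw (hSPT h),
    fun w hw => hαT.card_eq hw, h3, fun σ hσ => (tsum_normSq_sum_le_tsum_jsCoeff (hsumJ σ hσ)).1,
    eventually_tsum_normSq_sum_le_of_pole hb hsumJ hc⟩

end Summit.Langlands.Langlands.Theorems.FrobeniusMomentIrreducibilityIrreducibleOfMoments

end
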